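import Summits.AtomisticToContinuum.HydrodynamicLimit.Theorems.AntiMazurCoboundariesCorrectorPressureDecayKiferCanonicalLocalLimitTranslation
import Literature.MathematicalPhysics.StatisticalMechanics.LowDensityHardSphereGibbsUniqueness
import Mathlib.MeasureTheory.Measure.Haar.InnerProductSpace

/-!
# Mean particle number of a large free box vs. the density of the Gibbs state (line `FirstLemma`, crux stmt-AtomisticToContinuum-14135)

Registered stub `c9_free_mean_count_sub_density_mul_volume_le` (lead seat c9; piece (B1) of the thermodynamic step of the
Gibbs route of the tangent entropy bound), namespace `Summit.AtomisticToContinuum.HydrodynamicLimit.Theorems.KiferCompactification`: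
for `0 < z ≤ 1/64`, `β > 0`, a translation-invariant DLR state `G` of the unit-diameter hard-sphere gas at activity `z`
(`IsHardSphereGibbs 1 z β u G`) and the FREE grand-canonical measures `R_n = gibbsSpecMeasure 1 z β u Λ_n ∅` on the centred
cubes `Λ_n = centredBox n = [-(n+1), n+1)³`, the mean particle number of `R_n` is `density G · (2(n+1))³ + O((n+1)²)`.

Proof (all inputs are tree theorems). (i) GNZ for the free measure, `E_{R_n}[N] = z ∫_{Λ_n} R_n{no centre in B(q,1)} dq`
(`HardSphereDLR.lintegral_count_gibbsSpecMeasure_eq`, `lintegral_freeVolume_eq`; under `R_n` every particle lies above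
`Λ_n`), and the one-point GNZ identity `density G = z G{no centre in B(0,1)}` (`density_eq_activity_mul_measure_ball_empty`).
(ii) At a point `q` with `B(q, d+3) ⊆ Λ_n` the two vacancy probabilities differ by `≤ C₀ 4^{-d}`
(`freeMean_abs_real_vacant_sub_le`): after translating by `-q` (covariance `hsLocalSpec_shift` of the Poisson-form
specification, bridge `hsLocalSpec_eq_gibbsSpec`), the free box measure is, by consistency
(`lintegral_hsLocalSpec_hsLocalSpec_empty`), a `γ_{B(0,d+3)}`-mixture over hard-core boundary conditions, hence pinned by
the free ball value (`abs_measureReal_sub_hsLocalSpec_empty_le_of_mixture`, the Michelen–Perkins boundary-influence bound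
at `16 z ≤ 1/4`), and so is the DLR state `G` (`abs_measureReal_vacant_sub_hsLocalSpec_empty_le`). (iii) Layer cake over
the cubes `Q_d = [-(n+1-d), n+1-d]³ ⊇ Λ_n`: error `≤ C 4^{-d}` on `Q_d`, `|Q_d \ Q_{d+1}| ≤ 24 (n+1)²`, `∑_d 4^{-d} ≤ 2`.

References: D. Ruelle, *Statistical Mechanics: Rigorous Results* (1969) §4.2; M. Michelen, W. Perkins, arXiv:2109.01094,
Thm 25 (disagreement bound); D. Dereudre, LNM 2237 (2019), Thm 2 and Prop. 10 (GNZ). No new definitions, no named facts.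
-/

noncomputable section

open MeasureTheory ProbabilityTheory Set Filter Topology
open scoped ENNReal NNReal

namespace Summit.AtomisticToContinuum.HydrodynamicLimit.Theorems.KiferCompactification

open Literature.MathematicalPhysics.KineticTheory (V3)
open Literature.MathematicalPhysics.KineticTheory.HardSphereDLR (gibbsSpecMeasure lintegral_gibbsSpecMeasure
  lintegral_gibbsWeightMeasure measurable_toENNReal_count mem_superposeIn_iff measurable_ballCount gibbsSpecMeasure_apply)
open Literature.MathematicalPhysics.KineticTheory.PointProcess (centredBox density)
open Literature.Analysis.FluidPDE (IsHardSphereGibbs IsTranslationInvariant superposeIn)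
open Literature.Analysis.FunctionSpaces (PointConfig)

/-! ## Geometry of the coordinate cubes -/

/-- Coordinate cubes `{x | ∀ i, xᵢ ∈ S}` over a measurable `S ⊆ ℝ` are measurable. -/
theorem freeMean_measurableSet_coordCube {S : Set ℝ} (hS : MeasurableSet S) : MeasurableSet {x : V3 | ∀ i, x i ∈ S} := by
  have h : {x : V3 | ∀ i, x i ∈ S} = ⋂ i, (fun y : V3 => y i) ⁻¹' S := by ext y; simp
  rw [h]
  exact MeasurableSet.iInter fun i => hS.preimage (by fun_prop)

/-- The coordinate cube `{x | ∀ i, xᵢ ∈ S}` has volume `|S|³`. -/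
theorem freeMean_volume_coordCube {S : Set ℝ} (hS : MeasurableSet S) : volume {x : V3 | ∀ i, x i ∈ S} = volume S ^ 3 := by
  have h : {x : V3 | ∀ i, x i ∈ S} = (WithLp.ofLp : V3 → Fin 3 → ℝ) ⁻¹' Set.pi univ fun _ => S := by ext y; simp
  rw [h, (PiLp.volume_preserving_ofLp (Fin 3)).measure_preimage (MeasurableSet.univ_pi fun _ => hS).nullMeasurableSet,
    volume_pi_pi]
  simp

/-- The centred cube `Λ_n` has volume `(2(n+1))³`. -/
theorem freeMean_volume_centredBox (n : ℕ) : volume (centredBox (d := Fin 3) n) = ENNReal.ofReal (2 * ((n : ℝ) + 1)) ^ 3 := by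
  rw [show centredBox (d := Fin 3) n = {x : V3 | ∀ i, x i ∈ Ico (-((n : ℝ) + 1)) ((n : ℝ) + 1)} from rfl,
    freeMean_volume_coordCube measurableSet_Ico, Real.volume_Ico]
  congr 2
  ring

/-- The closed cube `Q(a) = [-a, a]³` has volume `(2a)³` (and is empty, of volume `0`, for `a < 0`). -/
theorem freeMean_volume_cube (a : ℝ) : volume {x : V3 | ∀ i, x i ∈ Icc (-a) a} = ENNReal.ofReal (2 * a) ^ 3 := by
  rw [freeMean_volume_coordCube measurableSet_Icc, Real.volume_Icc]
  congr 2
  ring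

/-- A ball of radius `r` around a point of the cube `Q(a)` with `a + r ≤ n + 1` lies in `Λ_n`. -/
theorem freeMean_ball_subset_centredBox {n : ℕ} {a r : ℝ} {q : V3} (hq : q ∈ {x : V3 | ∀ i, x i ∈ Icc (-a) a})
    (hr : a + r ≤ (n : ℝ) + 1) : Metric.ball q r ⊆ centredBox (d := Fin 3) n := by
  intro y hy i
  rw [Metric.mem_ball, dist_eq_norm] at hy
  have hi : |y i - q i| < r := lt_of_le_of_lt (by simpa using PiLp.norm_apply_le (y - q) i) hy
  rw [abs_lt] at hi
  have h1 := (hq i).1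
  have h2 := (hq i).2
  constructor <;> linarith

/-- **Volume of the shells**: `|Q(n+1-d) \ Q(n-d)| ≤ 24 (n+1)²` (`(2a)³ - (2a-2)³ = 24a² - 24a + 8 ≤ 24a²` for `a ≥ 1`,
and `|Q(a)| ≤ 8` for `a < 1`). -/
theorem freeMean_volume_shell_le (n d : ℕ) :
    volume ({x : V3 | ∀ i, x i ∈ Icc (-((n : ℝ) + 1 - d)) ((n : ℝ) + 1 - d)} \
      {x : V3 | ∀ i, x i ∈ Icc (-((n : ℝ) + 1 - (d + 1 : ℕ))) ((n : ℝ) + 1 - (d + 1 : ℕ))}) ≤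
      ENNReal.ofReal (24 * ((n : ℝ) + 1) ^ 2) := by
  set a : ℝ := (n : ℝ) + 1 - d with ha
  have han : a ≤ (n : ℝ) + 1 := by rw [ha]; linarith [d.cast_nonneg (α := ℝ)]
  have hn1 : (1 : ℝ) ≤ ((n : ℝ) + 1) ^ 2 := by nlinarith [n.cast_nonneg (α := ℝ)]
  rw [show (n : ℝ) + 1 - ((d + 1 : ℕ) : ℝ) = a - 1 by rw [ha]; push_cast; ring]
  have hsub : {x : V3 | ∀ i, x i ∈ Icc (-(a - 1)) (a - 1)} ⊆ {x : V3 | ∀ i, x i ∈ Icc (-a) a} := fun x hx i =>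
    ⟨by linarith [(hx i).1], by linarith [(hx i).2]⟩
  rw [measure_sdiff hsub (freeMean_measurableSet_coordCube measurableSet_Icc).nullMeasurableSet
    (by rw [freeMean_volume_cube]; exact ENNReal.pow_ne_top ENNReal.ofReal_ne_top), freeMean_volume_cube, freeMean_volume_cube]
  rcases le_or_gt 1 a with h1 | h1
  · rw [← ENNReal.ofReal_pow (by linarith), ← ENNReal.ofReal_pow (by linarith), ← ENNReal.ofReal_sub _ (by positivity)]
    exact ENNReal.ofReal_le_ofReal (by nlinarith [mul_self_le_mul_self (show 0 ≤ a by linarith) han])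
  · calc ENNReal.ofReal (2 * a) ^ 3 - ENNReal.ofReal (2 * (a - 1)) ^ 3 ≤ ENNReal.ofReal 2 ^ 3 :=
          tsub_le_self.trans (by gcongr; linarith)
      _ ≤ ENNReal.ofReal (24 * ((n : ℝ) + 1) ^ 2) := by
          rw [← ENNReal.ofReal_pow zero_le_two]
          exact ENNReal.ofReal_le_ofReal (by nlinarith)

/-- **Layer-cake bound.** With `Q_d = [-(n+1-d), n+1-d]³` (so `Q_0 ⊇ Λ_n`, `Q_d = ∅` for `d > n+1`): if
`f ≤ C 4^{-d}` on `Q_d` for every `d`, then `∫_{Λ_n} f ≤ 48 C (n+1)²` (the shells `Q_d \ Q_{d+1}` cover `Λ_n`, each has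
volume `≤ 24 (n+1)²`, and `∑_d 4^{-d} ≤ ∑_d 2^{-d} = 2`). -/
theorem freeMean_setLIntegral_centredBox_le {f : V3 → ℝ≥0∞} {C : ℝ} (hC : 0 ≤ C) (n : ℕ) (Q : ℕ → Set V3)
    (hQ : ∀ d : ℕ, Q d = {x : V3 | ∀ i, x i ∈ Icc (-((n : ℝ) + 1 - d)) ((n : ℝ) + 1 - d)})
    (hd : ∀ (d : ℕ) (q : V3), q ∈ Q d → f q ≤ ENNReal.ofReal (C * (1 / 4 : ℝ) ^ d)) :
    ∫⁻ q in centredBox (d := Fin 3) n, f q ≤ ENNReal.ofReal (48 * C * ((n : ℝ) + 1) ^ 2) := by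
  -- the shells cover the cube
  have hcover : centredBox (d := Fin 3) n ⊆ ⋃ d : ℕ, (Q d \ Q (d + 1)) := by
    intro x hx
    rw [mem_iUnion]
    by_contra hne
    push Not at hne
    have hall : ∀ d : ℕ, x ∈ Q d := by
      intro d
      induction d with
      | zero => rw [hQ]; exact fun i => ⟨by have h := (hx i).1; push_cast; linarith, by have h := (hx i).2; push_cast; linarith⟩
      | succ d ih => have h := hne d; rw [Set.mem_sdiff, not_and, not_not] at h; exact h ih
    have h := hall (n + 2)
    rw [hQ] at h
    obtain ⟨h1, h2⟩ := h 0
    push_cast at h1 h2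
    linarith
  -- each shell contributes `≤ 24 C (n+1)² 2^{-d}`
  have hshell : ∀ d : ℕ, ∫⁻ q in Q d \ Q (d + 1), f q ≤ ENNReal.ofReal (24 * C * ((n : ℝ) + 1) ^ 2) * (2⁻¹ : ℝ≥0∞) ^ d := by
    intro d
    have h4 : (1 / 4 : ℝ) ^ d ≤ (2⁻¹ : ℝ) ^ d := pow_le_pow_left₀ (by norm_num) (by norm_num) d
    calc ∫⁻ q in Q d \ Q (d + 1), f q ≤ ∫⁻ _ in Q d \ Q (d + 1), ENNReal.ofReal (C * (1 / 4 : ℝ) ^ d) :=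
          setLIntegral_mono measurable_const fun q hq => hd d q hq.1
      _ ≤ ENNReal.ofReal (C * (1 / 4 : ℝ) ^ d) * ENNReal.ofReal (24 * ((n : ℝ) + 1) ^ 2) := by
          rw [setLIntegral_const, hQ, hQ]
          exact mul_le_mul_right (freeMean_volume_shell_le n d) _
      _ ≤ ENNReal.ofReal (24 * C * ((n : ℝ) + 1) ^ 2 * (2⁻¹ : ℝ) ^ d) := by
          rw [← ENNReal.ofReal_mul (by positivity)]
          refine ENNReal.ofReal_le_ofReal ?_
          calc C * (1 / 4 : ℝ) ^ d * (24 * ((n : ℝ) + 1) ^ 2) = 24 * C * ((n : ℝ) + 1) ^ 2 * (1 / 4 : ℝ) ^ d := by ring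
            _ ≤ 24 * C * ((n : ℝ) + 1) ^ 2 * (2⁻¹ : ℝ) ^ d := mul_le_mul_of_nonneg_left h4 (by positivity)
      _ = ENNReal.ofReal (24 * C * ((n : ℝ) + 1) ^ 2) * (2⁻¹ : ℝ≥0∞) ^ d := by
          rw [ENNReal.ofReal_mul (by positivity), ENNReal.ofReal_pow (by positivity), ENNReal.ofReal_inv_of_pos two_pos,
            ENNReal.ofReal_ofNat]
  calc ∫⁻ q in centredBox (d := Fin 3) n, f q ≤ ∫⁻ q in ⋃ d : ℕ, (Q d \ Q (d + 1)), f q := lintegral_mono_set hcover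
    _ ≤ ∑' d : ℕ, ∫⁻ q in Q d \ Q (d + 1), f q := lintegral_iUnion_le _ _
    _ ≤ ∑' d : ℕ, ENNReal.ofReal (24 * C * ((n : ℝ) + 1) ^ 2) * (2⁻¹ : ℝ≥0∞) ^ d := ENNReal.tsum_le_tsum hshell
    _ = ENNReal.ofReal (48 * C * ((n : ℝ) + 1) ^ 2) := by
        rw [ENNReal.tsum_mul_left, ENNReal.tsum_geometric_two, ← ENNReal.ofReal_ofNat 2,
          ← ENNReal.ofReal_mul' (by positivity)]
        congr 1
        ring

/-! ## From pointwise to integrated bounds; two facts about the free measure -/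

/-- `a ≤ b + |a - b|` in `ℝ≥0∞` (finite `a`, `b`; the difference taken in `ℝ`). -/
theorem freeMean_le_add_ofReal_abs_sub {a b : ℝ≥0∞} (ha : a ≠ ∞) (hb : b ≠ ∞) :
    a ≤ b + ENNReal.ofReal |a.toReal - b.toReal| := by
  rw [← ENNReal.toReal_le_toReal ha (ENNReal.add_ne_top.2 ⟨hb, ENNReal.ofReal_ne_top⟩),
    ENNReal.toReal_add hb ENNReal.ofReal_ne_top, ENNReal.toReal_ofReal (abs_nonneg _)]
  linarith [le_abs_self (a.toReal - b.toReal)]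

/-- **From the pointwise to the integrated comparison**: if `r ≤ 1` is measurable, `g` is finite and
`∫_Λ |r(q) - g| dq ≤ K`, then `|∫_Λ r - g |Λ|| ≤ K` (integrate `r ≤ g + |r - g|` and `g ≤ r + |r - g|` over `Λ`). -/
theorem freeMean_abs_toReal_setLIntegral_sub_le {Λ : Set V3} (hΛv : volume Λ ≠ ∞) {r : V3 → ℝ≥0∞} (hr : Measurable r)
    (hr1 : ∀ q, r q ≤ 1) {g : ℝ≥0∞} (hg : g ≠ ∞) {K : ℝ} (hK : 0 ≤ K)
    (hE : ∫⁻ q in Λ, ENNReal.ofReal |(r q).toReal - g.toReal| ≤ ENNReal.ofReal K) :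
    |(∫⁻ q in Λ, r q).toReal - g.toReal * (volume Λ).toReal| ≤ K := by
  have hrfin : ∀ q, r q ≠ ∞ := fun q => ne_top_of_le_ne_top ENNReal.one_ne_top (hr1 q)
  have hIle : ∫⁻ q in Λ, r q ≤ g * volume Λ + ∫⁻ q in Λ, ENNReal.ofReal |(r q).toReal - g.toReal| := by
    calc ∫⁻ q in Λ, r q ≤ ∫⁻ q in Λ, (g + ENNReal.ofReal |(r q).toReal - g.toReal|) :=
          lintegral_mono fun q => freeMean_le_add_ofReal_abs_sub (hrfin q) hg
      _ = _ := by rw [lintegral_add_left measurable_const, setLIntegral_const]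
  have hJle : g * volume Λ ≤ (∫⁻ q in Λ, r q) + ∫⁻ q in Λ, ENNReal.ofReal |(r q).toReal - g.toReal| := by
    calc g * volume Λ = ∫⁻ _ in Λ, g := (setLIntegral_const _ _).symm
      _ ≤ ∫⁻ q in Λ, (r q + ENNReal.ofReal |(r q).toReal - g.toReal|) :=
          lintegral_mono fun q => by simpa only [abs_sub_comm] using freeMean_le_add_ofReal_abs_sub hg (hrfin q)
      _ = _ := lintegral_add_left hr _
  have hIfin : ∫⁻ q in Λ, r q ≠ ∞ := by
    refine ne_top_of_le_ne_top ?_ (lintegral_mono fun q => hr1 q)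
    rwa [setLIntegral_const, one_mul]
  have hEfin := ne_top_of_le_ne_top ENNReal.ofReal_ne_top hE
  have h1 := ENNReal.toReal_mono (ENNReal.add_ne_top.2 ⟨ENNReal.mul_ne_top hg hΛv, hEfin⟩) hIle
  have h2 := ENNReal.toReal_mono (ENNReal.add_ne_top.2 ⟨hIfin, hEfin⟩) hJle
  rw [ENNReal.toReal_add (ENNReal.mul_ne_top hg hΛv) hEfin, ENNReal.toReal_mul] at h1
  rw [ENNReal.toReal_add hIfin hEfin, ENNReal.toReal_mul] at h2
  have h3 := ENNReal.toReal_le_of_le_ofReal hK hE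
  exact abs_sub_le_iff.2 ⟨by linarith, by linarith⟩

/-- The vacancy probability `q ↦ μ{no centre in B(q, ε)}` is a measurable function of the centre. -/
theorem freeMean_measurable_measure_vacant (μ : Measure (PointConfig (V3 × V3))) [SFinite μ] (ε : ℝ) :
    Measurable fun q : V3 => μ {X : PointConfig (V3 × V3) | X.count (Metric.ball q ε ×ˢ (univ : Set V3)) = 0} := by
  have hT : MeasurableSet {r : V3 × PointConfig (V3 × V3) | r.2.count (Metric.ball r.1 ε ×ˢ (univ : Set V3)) = 0} := by
    have h := measurable_ballCount ε
      (measurable_snd : Measurable fun r : V3 × PointConfig (V3 × V3) => r.2) measurable_fst (measurableSet_singleton 0)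
    refine (congrArg MeasurableSet (Set.ext fun r => ?_)).mp h
    simp only [mem_preimage, mem_singleton_iff, ENat.toENNReal_eq_zero, mem_setOf_eq]
  exact measurable_measure_prodMk_left hT

/-- **Under the free measure every particle lies above the window**: the mean total particle number of
`γ_Λ(· | ∅)` is the mean number of particles with position in `Λ`. -/
theorem freeMean_lintegral_count_univ_eq (ε z β : ℝ) (u : V3) {Λ : Set V3} (hΛ : MeasurableSet Λ) :
    ∫⁻ X, ((X.count univ : ℕ∞) : ℝ≥0∞) ∂(gibbsSpecMeasure ε z β u Λ ∅) =
      ∫⁻ X, ((X.count (Λ ×ˢ (univ : Set V3)) : ℕ∞) : ℝ≥0∞) ∂(gibbsSpecMeasure ε z β u Λ ∅) := by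
  rw [lintegral_gibbsSpecMeasure, lintegral_gibbsSpecMeasure,
    lintegral_gibbsWeightMeasure ε z β u hΛ ∅ (measurable_toENNReal_count MeasurableSet.univ),
    lintegral_gibbsWeightMeasure ε z β u hΛ ∅ (measurable_toENNReal_count (hΛ.prod MeasurableSet.univ))]
  congr 1
  refine tsum_congr fun k => ?_
  congr 1
  refine lintegral_congr fun x => ?_
  have hsub : (superposeIn Λ x (∅ : PointConfig (V3 × V3))).carrier ∩ Λ ×ˢ (univ : Set V3) =
      (superposeIn Λ x (∅ : PointConfig (V3 × V3))).carrier := by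
    refine Set.inter_eq_left.2 fun p hp => ?_
    rcases (mem_superposeIn_iff Λ x ∅ p).1 hp with ⟨-, hpΛ⟩ | ⟨hpe, -⟩
    · exact ⟨hpΛ, mem_univ _⟩
    · exact absurd (show p ∈ (∅ : PointConfig (V3 × V3)).carrier from hpe) (by simp)
  simp only [PointConfig.count, Set.inter_univ, hsub]

/-! ## The vacancy probabilities of the free box measure at interior points -/

section Vacancy

open Literature.Analysis.FunctionSpaces (maxwellianBeta)
open Literature.MathematicalPhysics.StatisticalMechanics (hsLocalSpec_eq_gibbsSpec isHsLocalGibbs_of_isHardSphereGibbs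
  smul_prod_uniqueness_hypotheses abs_measureReal_vacant_sub_hsLocalSpec_empty_le
  isProbabilityMeasure_withDensity_maxwellianBeta smul_prod_map_add smul_prod_window preimage_restrict_window_ceil_vacant)
open Literature.MathematicalPhysics.StatisticalMechanics.HardSphere (window shift shift_empty measurable_shift
  IsHardCore isHardCore_empty measurableSet_window)
open Literature.MathematicalPhysics.KineticTheory (hsLocalSpec IsHsLocalGibbs hsLocalSpec_shift
  lintegral_hsLocalSpec_hsLocalSpec_empty abs_measureReal_sub_hsLocalSpec_empty_le_of_mixture isProbabilityMeasure_hsLocalSpec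
  hsLocalSpec_ae_isHardCore measurableSet_preimage_add isBounded_preimage_add measurableSet_count_eq_zero)

/-- **The free box measure and the Gibbs state have exponentially close vacancy probabilities at interior points**:
for `0 < z ≤ 1/64`, `β > 0` and a DLR state `G` of the unit-diameter hard-sphere gas at activity `z` there is `C₀` with
`|γ_Λ(· | ∅){no centre in B(q,1)} - G{no centre in B(0,1)}| ≤ C₀ 4^{-d}` whenever `Λ` is bounded measurable and
`B(q, d+3) ⊆ Λ` (translate by `-q`; the translated free box measure and `G` are both `γ_{B(0,d+3)}`-mixtures over hard-core
boundary conditions — consistency, resp. DLR — hence both are pinned by the free ball value; see the module docstring). -/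
theorem freeMean_abs_real_vacant_sub_le {z β : ℝ} {u : V3} (hz : 0 < z) (hz1 : z ≤ 1 / 64) (hβ : 0 < β)
    {G : Measure (PointConfig (V3 × V3))} (hG : IsHardSphereGibbs 1 z β u G) :
    ∃ C₀ : ℝ, 0 ≤ C₀ ∧ ∀ {Λ : Set V3}, MeasurableSet Λ → Bornology.IsBounded Λ → ∀ (d : ℕ) (q : V3),
      Metric.ball q ((d : ℝ) + 3) ⊆ Λ →
        |(gibbsSpecMeasure 1 z β u Λ ∅).real {X : PointConfig (V3 × V3) | X.count (Metric.ball q 1 ×ˢ (univ : Set V3)) = 0} -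
          G.real {X : PointConfig (V3 × V3) | X.count (Metric.ball 0 1 ×ˢ (univ : Set V3)) = 0}| ≤ C₀ * (1 / 4 : ℝ) ^ d := by
  haveI := isProbabilityMeasure_withDensity_maxwellianBeta hβ u
  have h16 : 16 * (z * (1 : ℝ) ^ 3) < 1 := by rw [one_pow, mul_one]; linarith
  obtain ⟨h0, hm, hκ0, hκ, -, hfin⟩ := smul_prod_uniqueness_hypotheses one_pos hz.le h16 hβ u
  set M : Measure V3 := (volume : Measure V3).withDensity fun v => ENNReal.ofReal (maxwellianBeta β (v - u)) with hM
  set ν : Measure (V3 × V3) := (Real.toNNReal z) • ((volume : Measure V3).prod M) with hν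
  haveI : IsLocallyFiniteMeasure ν := by rw [hν]; infer_instance
  have hGl : IsHsLocalGibbs 1 ν G := isHsLocalGibbs_of_isHardSphereGibbs u hz.le hβ hG
  have hz64 : z ≤ 1 / (64 * (1 : ℝ) ^ 3) := by rw [one_pow, mul_one]; exact hz1
  -- the constants of the two pinning estimates
  set CG : ℝ := 2 * ((2 * (⌈(1 : ℝ)⌉₊ : ℕ)) ^ 3 / (64 * (1 : ℝ) ^ 3)) *
    Real.exp ((2 * (⌈(1 : ℝ)⌉₊ : ℕ)) ^ 3 / (64 * (1 : ℝ) ^ 3)) with hCG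
  set CF : ℝ := 2 * ν.real (window (Metric.ball (0 : V3) (⌈(1 : ℝ)⌉₊ : ℕ))) *
    Real.exp (ν.real (window (Metric.ball (0 : V3) (⌈(1 : ℝ)⌉₊ : ℕ)))) with hCF
  refine ⟨CG + CF, by positivity, fun {Λ} hΛ hΛb d q hq => ?_⟩
  set V : Set (PointConfig (V3 × V3)) := {c | c.count (window (Metric.ball (0 : V3) 1)) = 0} with hV
  set Vq : Set (PointConfig (V3 × V3)) := {X | X.count (Metric.ball q 1 ×ˢ (univ : Set V3)) = 0} with hVq
  have hVeq : {X : PointConfig (V3 × V3) | X.count (Metric.ball 0 1 ×ˢ (univ : Set V3)) = 0} = V := rfl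
  have hVm : MeasurableSet V := measurableSet_count_eq_zero (measurableSet_window Metric.isOpen_ball.measurableSet)
  have hVqm : MeasurableSet Vq := measurableSet_count_eq_zero (Metric.isOpen_ball.measurableSet.prod MeasurableSet.univ)
  -- (1) the Gibbs state is pinned by the free ball measure
  have h1 := abs_measureReal_vacant_sub_hsLocalSpec_empty_le M one_pos hz.le hz64 hGl d
  -- (2) the translated free box measure is pinned by the same free ball measure
  set Λ' : Set V3 := (· + q) ⁻¹' Λ with hΛ'
  have hΛ'm : MeasurableSet Λ' := measurableSet_preimage_add q hΛ
  have hΛ'b : Bornology.IsBounded Λ' := isBounded_preimage_add q hΛb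
  have hfinΛ' : ν (window Λ') ≠ ∞ := by
    rw [hν, smul_prod_window, measure_univ, mul_one]
    exact ENNReal.mul_ne_top ENNReal.ofReal_ne_top hΛ'b.measure_lt_top.ne
  haveI : IsProbabilityMeasure (hsLocalSpec 1 ν Λ' ∅) :=
    isProbabilityMeasure_hsLocalSpec ν h0 hΛ'm hfinΛ' ((isHardCore_empty 1).restrict _)
  have hρhc : ∀ᵐ η ∂(hsLocalSpec 1 ν Λ' ∅), IsHardCore 1 η := hsLocalSpec_ae_isHardCore ν 1 Λ' ∅
  have hball : Metric.ball (0 : V3) ((⌈(1 : ℝ)⌉₊ : ℕ) + ((d : ℝ) + 2) * 1) ⊆ Λ' := by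
    intro y hy
    rw [Nat.ceil_one, Nat.cast_one, mul_one, Metric.mem_ball, dist_zero_right] at hy
    show y + q ∈ Λ
    refine hq ?_
    rw [Metric.mem_ball, dist_eq_norm, add_sub_cancel_right]
    linarith
  have hAm : MeasurableSet (PointConfig.restrict (window (Metric.ball (0 : V3) ((⌈(1 : ℝ)⌉₊ : ℕ) : ℝ))) ⁻¹' V) :=
    hVm.preimage (PointConfig.measurable_restrict (measurableSet_window Metric.isOpen_ball.measurableSet))
  have hmix := lintegral_hsLocalSpec_hsLocalSpec_empty ν h0 (σ := 1) Metric.isOpen_ball.measurableSet hΛ'm hball hAm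
  have h2 := abs_measureReal_sub_hsLocalSpec_empty_le_of_mixture ν one_pos h0 hm hκ0 hκ hfin hρhc (⌈(1 : ℝ)⌉₊) d hVm hmix
  rw [hV, preimage_restrict_window_ceil_vacant, ← hV] at h2
  -- (3) the free box measure at `q` is the translated free measure at `0`
  have hRρ : (gibbsSpecMeasure 1 z β u Λ ∅).real Vq = (hsLocalSpec 1 ν Λ' ∅).real V := by
    simp only [measureReal_def]
    congr 1
    rw [gibbsSpecMeasure_apply 1 z β u hΛ ∅ hVqm, ← hsLocalSpec_eq_gibbsSpec u hz.le hβ hΛ hΛb (isHardCore_empty 1) hVqm]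
    have hsh := hsLocalSpec_shift (σ := 1) (a := q) h0 (smul_prod_map_add z M q) hΛ (∅ : PointConfig (V3 × V3))
    rw [shift_empty] at hsh; rw [hsh, Measure.map_apply (measurable_shift q) hVqm]
    congr 1
    ext c
    simp only [hVq, hV, mem_preimage, mem_setOf_eq, shift, PointConfig.count_translate]
    have hset : (fun p : V3 × V3 => p + (q, 0)) ⁻¹' (Metric.ball q 1 ×ˢ (univ : Set V3)) = window (Metric.ball (0 : V3) 1) := by
      ext p
      simp [window, Metric.mem_ball, dist_eq_norm]
    rw [hset]
  -- (4) combine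
  have hpow : CF * (2 * (8 * (z * (1 : ℝ) ^ 3))) ^ d ≤ CF * (1 / 4 : ℝ) ^ d :=
    mul_le_mul_of_nonneg_left (pow_le_pow_left₀ (by positivity) (by linarith) d) (by positivity)
  rw [hRρ, hVeq]
  rw [abs_sub_comm, ← hCG] at h1
  rw [← hCF] at h2
  refine (abs_sub_le _ _ _).trans ((add_le_add h2 h1).trans ?_)
  linarith [hpow]

end Vacancy

/-! ## The mean particle number of a free box -/

section Main

open Literature.MathematicalPhysics.KineticTheory.HardSphereDLR (lintegral_count_gibbsSpecMeasure_eq lintegral_freeVolume_eq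
  density_eq_activity_mul_measure_ball_empty gibbsSpecMeasure_univ_le_one)

/-- W3-3 (B1), registered stub `c9_free_mean_count_sub_density_mul_volume_le`: **the mean particle number of a large free
box is the density of the Gibbs state times the volume, up to a surface term.**  For `0 < z ≤ 1/64`, `β > 0`, a
translation-invariant DLR state `G` of the unit-diameter hard-sphere gas at activity `z` with density `ρ = density G`,
and the free grand-canonical measures `R_n = γ_{Λ_n}(· | ∅)` on the centred cubes `Λ_n = [-(n+1), n+1)³`:
`|E_{R_n}[N] - ρ (2(n+1))³| ≤ C (n+1)²` (GNZ on both sides reduces this to `z ∫_{Λ_n} |R_n{…B(q,1)…} - G{…B(0,1)…}| dq`; the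
integrand is `≤ 1` on `Q_d`, `d < 3`, and `≤ C₀ 4^{-(d-3)}` on `Q_d`, `d ≥ 3`, as `B(q, d) ⊆ Λ_n` there; then layer cake). -/
theorem c9_free_mean_count_sub_density_mul_volume_le {z β : ℝ} {u : V3} (hz : 0 < z) (hz1 : z ≤ 1 / 64) (hβ : 0 < β)
    {G : Measure (PointConfig (V3 × V3))} (hG : IsHardSphereGibbs 1 z β u G) (hGT : IsTranslationInvariant G) :
    ∃ C : ℝ, ∀ n : ℕ,
      |(∫⁻ ω, ((ω.count univ : ℕ∞) : ℝ≥0∞) ∂(gibbsSpecMeasure 1 z β u (centredBox n) ∅)).toReal -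
          (density G).toReal * (2 * ((n : ℝ) + 1)) ^ 3| ≤ C * ((n : ℝ) + 1) ^ 2 := by
  obtain ⟨C₀, hC₀, hcmp⟩ := freeMean_abs_real_vacant_sub_le hz hz1 hβ hG
  refine ⟨z * (48 * (64 * (1 + C₀))), fun n => ?_⟩
  haveI : IsProbabilityMeasure G := hG.1
  have hΛ : MeasurableSet (centredBox (d := Fin 3) n) := measurableSet_centredBox_fin3 n
  have hvol := freeMean_volume_centredBox n
  haveI : IsFiniteMeasure (gibbsSpecMeasure 1 z β u (centredBox (d := Fin 3) n) ∅) :=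
    ⟨(gibbsSpecMeasure_univ_le_one 1 z β u hΛ ∅).trans_lt ENNReal.one_lt_top⟩
  have hR1 : ∀ q : V3, gibbsSpecMeasure 1 z β u (centredBox (d := Fin 3) n) ∅
      {X : PointConfig (V3 × V3) | X.count (Metric.ball q 1 ×ˢ (univ : Set V3)) = 0} ≤ 1 := fun q =>
    (measure_mono (subset_univ _)).trans (gibbsSpecMeasure_univ_le_one 1 z β u hΛ ∅)
  -- the pointwise comparison on the cubes `Q_d = [-(n+1-d), n+1-d]³`
  have hd : ∀ (d : ℕ) (q : V3), q ∈ {x : V3 | ∀ i, x i ∈ Icc (-((n : ℝ) + 1 - d)) ((n : ℝ) + 1 - d)} →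
      ENNReal.ofReal |(gibbsSpecMeasure 1 z β u (centredBox (d := Fin 3) n) ∅
          {X : PointConfig (V3 × V3) | X.count (Metric.ball q 1 ×ˢ (univ : Set V3)) = 0}).toReal -
        (G {X : PointConfig (V3 × V3) | X.count (Metric.ball 0 1 ×ˢ (univ : Set V3)) = 0}).toReal| ≤
      ENNReal.ofReal (64 * (1 + C₀) * (1 / 4 : ℝ) ^ d) := by
    intro d q hq
    refine ENNReal.ofReal_le_ofReal ?_
    rcases lt_or_ge d 3 with hd | hd
    · -- `d < 3`: both probabilities lie in `[0, 1]`, and `64 (1 + C₀) 4^{-d} ≥ 4`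
      have hr : (gibbsSpecMeasure 1 z β u (centredBox (d := Fin 3) n) ∅
          {X : PointConfig (V3 × V3) | X.count (Metric.ball q 1 ×ˢ (univ : Set V3)) = 0}).toReal ≤ 1 :=
        ENNReal.toReal_le_of_le_ofReal zero_le_one (by rw [ENNReal.ofReal_one]; exact hR1 q)
      have hg : (G {X : PointConfig (V3 × V3) | X.count (Metric.ball 0 1 ×ˢ (univ : Set V3)) = 0}).toReal ≤ 1 :=
        ENNReal.toReal_le_of_le_ofReal zero_le_one (by rw [ENNReal.ofReal_one]; exact prob_le_one)
      have h16 : (1 / 16 : ℝ) ≤ (1 / 4 : ℝ) ^ d := by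
        interval_cases d <;> norm_num
      refine (abs_sub_le_of_nonneg_of_le ENNReal.toReal_nonneg hr ENNReal.toReal_nonneg hg).trans ?_
      nlinarith [h16, mul_nonneg hC₀ (pow_nonneg (show (0 : ℝ) ≤ 1 / 4 by norm_num) d)]
    · -- `d ≥ 3`: `B(q, (d-3)+3) ⊆ Λ_n`
      obtain ⟨k, rfl⟩ : ∃ k, d = k + 3 := ⟨d - 3, by omega⟩
      have hk := hcmp hΛ (isBounded_centredBox n) k q (freeMean_ball_subset_centredBox hq (by push_cast; linarith))
      refine hk.trans ?_
      rw [pow_add]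
      nlinarith [pow_nonneg (show (0 : ℝ) ≤ 1 / 4 by norm_num) k]
  -- the integrated comparison (layer cake), then GNZ on both sides
  have habs := freeMean_abs_toReal_setLIntegral_sub_le (by rw [hvol]; exact ENNReal.pow_ne_top ENNReal.ofReal_ne_top)
    (freeMean_measurable_measure_vacant _ 1) hR1 (measure_ne_top G _) (by positivity)
    (freeMean_setLIntegral_centredBox_le (by positivity) n _ (fun d => rfl) hd)
  rw [hvol, ENNReal.toReal_pow, ENNReal.toReal_ofReal (by positivity)] at habs
  rw [freeMean_lintegral_count_univ_eq 1 z β u hΛ, lintegral_count_gibbsSpecMeasure_eq 1 hz.le β u hΛ ∅,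
    lintegral_freeVolume_eq 1 hβ u (centredBox (d := Fin 3) n), density_eq_activity_mul_measure_ball_empty hG hGT hz.le hβ,
    ENNReal.toReal_mul, ENNReal.toReal_mul, ENNReal.toReal_ofReal hz.le]
  have key : ∀ A B : ℝ, |z * A - z * B * (2 * ((n : ℝ) + 1)) ^ 3| = z * |A - B * (2 * ((n : ℝ) + 1)) ^ 3| := fun A B => by
    rw [mul_assoc, ← mul_sub, abs_mul, abs_of_pos hz]
  rw [key]
  linarith [mul_le_mul_of_nonneg_left habs hz.le]

end Main

end Summit.AtomisticToContinuum.HydrodynamicLimit.Theorems.KiferCompactification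

end
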